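import Summits.BirchSwinnertonDyer.BirchSwinnertonDyer.Theorems.ResidualThetaTransportAtTwoThetaLayerLambdaCongruenceAtTwoStarAssemblyOfFacts
import HarnessLib

/-!
# Crux `ThetaLayerLambdaCongruenceAtTwo` (stmt-BirchSwinnertonDyer-20688, route ResidualThetaTransportAtTwo), line
# `birth` v9, stub (C3k): the lead's (K2) in ITS OWN CURRENCY, from B4 (four cosets) and the three named facts (width seat
# bsd-wall-rtt-p3-w3 g3; `--supports stmt-BirchSwinnertonDyer-20688 --as helper`; closes nothing)

HONEST FRAMING. A CONDITIONAL THEOREM (named facts: `eichlerShimura_depletedOptimalQuotient_periodLattice`,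
`isIsogenous_iff_frobeniusTrace_eq`, `mazurKenku_exists_cyclic_isogeny`) with the mod-`2` multiplicity-one input B4 as an explicit
hypothesis in the "four cosets of `𝔪₀Λ`" shape. It does not prove (K2) outright, nor (C3k), nor the crux; BSD is not proved by any
of this.

WHAT. Lines/birth-C3k-plan.md Addendum 2: (C3k) ⟸ (K2) = «every subgroup `K` of `Λ = periodHomology L` (here: of the dual space,
tested on `Λ`) containing `2Λ`, all `T_q^∨λ − a_q(W)λ` (`q ∤ L`), all `U_ℓ^∨λ` (`ℓ ∣ L`) and the cusp-negation differences has
`x, y ∈ Λ ∖ K ⇒ x − y ∈ K`». Here, at the depleted level `L = N·∏_{ℓ∈S} ℓ²` of `W` (`S ⊇ primes(N)` finite, so `q ∤ L ⟺ q ∉ S`):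
* `mem_of_mem_ideal_span_smul` (§1): such a `K` contains `𝔪₀ • Λ` for the explicit eigen-ideal
  `𝔪₀ = span{2, T_q − a_q(W) (q ∤ L prime), T_ℓ (ℓ ∣ L prime)} ⊆ HeckeRing0 L 2` (ideal generated ⇒ subgroup generated, because
  `Λ` is a `𝕋`-module);
* `kTwo_of_fourCosets_of_facts` (§2): (K2) for every such `K`, GIVEN B4 as «`Λ ⊆` the four `𝔪₀Λ`-cosets of `0, v₁, v₂, v₁+v₂`»
  — through `…StarAssemblyOfFacts.indexTwo_of_fourCosets_of_facts` (B5 witness `{∞,(εγ₀ε)∞} − {∞,γ₀∞} ∈ K ∖ 𝔪₀Λ`).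
So the (C3k) residue on this line is exactly B4 (mod-`2` multiplicity one for `𝔪₀` at level `L`, quotient form) plus the three
printed facts.

References: Lines/birth-C3k-plan.md Addendum 2; [CremonaAlgorithms1997] §2.10; [DarmonDiamondTaylor1995] §4.5 (Thm. 4.26 shape).
-/

noncomputable section

-- justification: the `Summit.BirchSwinnertonDyer.BirchSwinnertonDyer.…` path repeats a component (route-file convention)
set_option linter.dupNamespace false

open scoped MatrixGroups ComplexConjugate ModularForm

open CongruenceSubgroup Complex WeierstrassCurve
open Literature.NumberTheory.EllipticCurves Literature.NumberTheory.EllipticCurves.ModularForms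
open Literature.NumberTheory.EllipticCurves.Rank1Residual

namespace Summit.BirchSwinnertonDyer.BirchSwinnertonDyer.Theorems.ThetaLayerLambdaCongruenceAtTwo

/-! ## §1. Subgroups containing the generators' images contain `𝔪₀ • Λ` -/

section Generators

variable {L : ℕ} [NeZero L]

/-- The Hecke element `T_q` acts on the dual space as the transpose of the Hecke operator. [folklore] -/
theorem heckeRing0_T_smul (q : ℕ) (hq : q.Prime) (x : Module.Dual ℂ (CuspForm (Gamma0 L) 2)) :
    HeckeRing0.T L 2 q hq • x = (haveI : NeZero q := ⟨hq.ne_zero⟩; heckeT (Gamma0 L) 2 q).dualMap x := by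
  change HeckeRing0.dualAction L 2 (HeckeRing0.T L 2 q hq) x = _
  rw [HeckeRing0.dualAction_apply, HeckeRing0.toEnd_T]

/-- An integer of `𝕋` acts on the dual space as the scalar. [folklore] -/
theorem heckeRing0_intCast_smul (a : ℤ) (x : Module.Dual ℂ (CuspForm (Gamma0 L) 2)) :
    (a : HeckeRing0 L 2) • x = (a : ℂ) • x := by
  change HeckeRing0.dualAction L 2 (a : HeckeRing0 L 2) x = _
  rw [HeckeRing0.dualAction_apply, map_intCast]
  ext f
  rw [LinearMap.dualMap_apply, Module.End.intCast_apply, map_zsmul, LinearMap.smul_apply, Int.cast_smul_eq_zsmul]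

/-- **Ideal-generated ⇒ subgroup-generated on a `𝕋`-module.** If an additive subgroup `K` of the dual space contains `s • x`
for every generator `s ∈ G` and every `x ∈ Λ = periodHomology L`, then it contains `(Ideal.span G) • Λ` (since `Λ` is
`𝕋`-stable: `(∑ rᵢsᵢ) • x = ∑ sᵢ • (rᵢ • x)`). [folklore] -/
theorem mem_of_mem_ideal_span_smul (G : Set (HeckeRing0 L 2)) (K : AddSubgroup (Module.Dual ℂ (CuspForm (Gamma0 L) 2)))
    (hG : ∀ s ∈ G, ∀ x ∈ periodHomology L, s • x ∈ K) :
    ∀ x ∈ Ideal.span G • periodHomologyHecke L, x ∈ K := by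
  intro x hx
  refine Submodule.smul_induction_on (p := fun x ↦ x ∈ K) hx ?_ ?_
  · intro t ht y hy
    induction ht using Submodule.span_induction generalizing y with
    | mem s hs => exact hG s hs y ((mem_periodHomologyHecke L).mp hy)
    | zero => rw [zero_smul]; exact K.zero_mem
    | add a b _ _ ha hb => rw [add_smul]; exact K.add_mem (ha y hy) (hb y hy)
    | smul r a _ ha =>
      rw [smul_eq_mul, mul_comm, mul_smul]
      exact ha (r • y) ((periodHomologyHecke L).smul_mem r hy)
  · intro a b ha hb
    exact K.add_mem ha hb

end Generators

/-! ## §2. (K2) at the depleted level from B4 (four cosets) and the named facts -/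

section KTwo

/-- **(K2) from B4 and the facts.** `W/ℚ` globally minimal, good supersingular at `2`, `Δ_W < 0`, newform `f` of level `N`, `S` a
finite set of primes CONTAINING the primes of `N`, `L = N·∏_{ℓ∈S} ℓ²` (so `q ∤ L ⟺ q ∉ S`), `𝔪₀ = span{2, T_q − a_q(W) (q ∤ L),
T_ℓ (ℓ ∣ L)} ⊆ HeckeRing0 L 2`. ASSUME B4 in the shape: `Λ = periodHomology L` lies in the four `𝔪₀Λ`-cosets of `0, v₁, v₂, v₁+v₂`
(`v₂ ∈ Λ`). Then every additive subgroup `K` of `S₂(Γ₀(L))^∨` containing `2x`, `T_q^∨x − a_q(W)x` (`q ∤ L`), `U_ℓ^∨ x` (`ℓ ∣ L`)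
for all `x ∈ Λ`, and `{∞,(εγε)∞} − {∞,γ∞}` for all `γ`, satisfies `x, y ∈ Λ ∖ K ⇒ x − y ∈ K` — the lead's (K2). Facts used:
`eichlerShimura_depletedOptimalQuotient_periodLattice`, `isIsogenous_iff_frobeniusTrace_eq`, `mazurKenku_exists_cyclic_isogeny`.
[cite: CremonaAlgorithms1997, §2.10 (pp. 29–30)] -/
theorem kTwo_of_fourCosets_of_facts
    (hES : eichlerShimura_depletedOptimalQuotient_periodLattice)
    (hF : isIsogenous_iff_frobeniusTrace_eq) (hMK : mazurKenku_exists_cyclic_isogeny)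
    (W : WeierstrassCurve ℚ) [W.IsElliptic] [W.IsGloballyMinimal] (hss : GoodSS W 2) (hΔ : W.Δ < 0)
    {N : ℕ} [NeZero N] {f : CuspForm (Gamma0 N) 2} (hf : IsNewformOf W f)
    (S : Finset ℕ) (hS : ∀ ℓ ∈ S, ℓ.Prime) (hSne : S.Nonempty) (hSN : ∀ q : ℕ, q.Prime → q ∣ N → q ∈ S)
    (L : ℕ) [NeZero L] (hL : L = N * ∏ ℓ ∈ S, ℓ ^ 2)
    {v₁ v₂ : Module.Dual ℂ (CuspForm (Gamma0 L) 2)} (hv₂ : v₂ ∈ periodHomology L)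
    (hcos : ∀ x ∈ periodHomology L,
      x ∈ Ideal.span ({t : HeckeRing0 L 2 | t = 2 ∨ (∃ (q : ℕ) (hq : q.Prime), ¬ q ∣ L ∧
          t = HeckeRing0.T L 2 q hq - (W.LFunction q : HeckeRing0 L 2)) ∨ (∃ (q : ℕ) (hq : q.Prime), q ∣ L ∧
          t = HeckeRing0.T L 2 q hq)}) • periodHomologyHecke L ∨
      x - v₁ ∈ Ideal.span ({t : HeckeRing0 L 2 | t = 2 ∨ (∃ (q : ℕ) (hq : q.Prime), ¬ q ∣ L ∧
          t = HeckeRing0.T L 2 q hq - (W.LFunction q : HeckeRing0 L 2)) ∨ (∃ (q : ℕ) (hq : q.Prime), q ∣ L ∧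
          t = HeckeRing0.T L 2 q hq)}) • periodHomologyHecke L ∨
      x - v₂ ∈ Ideal.span ({t : HeckeRing0 L 2 | t = 2 ∨ (∃ (q : ℕ) (hq : q.Prime), ¬ q ∣ L ∧
          t = HeckeRing0.T L 2 q hq - (W.LFunction q : HeckeRing0 L 2)) ∨ (∃ (q : ℕ) (hq : q.Prime), q ∣ L ∧
          t = HeckeRing0.T L 2 q hq)}) • periodHomologyHecke L ∨
      x - (v₁ + v₂) ∈ Ideal.span ({t : HeckeRing0 L 2 | t = 2 ∨ (∃ (q : ℕ) (hq : q.Prime), ¬ q ∣ L ∧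
          t = HeckeRing0.T L 2 q hq - (W.LFunction q : HeckeRing0 L 2)) ∨ (∃ (q : ℕ) (hq : q.Prime), q ∣ L ∧
          t = HeckeRing0.T L 2 q hq)}) • periodHomologyHecke L)
    (K : AddSubgroup (Module.Dual ℂ (CuspForm (Gamma0 L) 2)))
    (h2K : ∀ x ∈ periodHomology L, (2 : ℂ) • x ∈ K)
    (hTK : ∀ (q : ℕ) (hq : q.Prime), ¬ q ∣ L → ∀ x ∈ periodHomology L,
      (haveI : NeZero q := ⟨hq.ne_zero⟩; heckeT (Gamma0 L) 2 q).dualMap x - (W.LFunction q : ℂ) • x ∈ K)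
    (hUK : ∀ (q : ℕ) (hq : q.Prime), q ∣ L → ∀ x ∈ periodHomology L,
      (haveI : NeZero q := ⟨hq.ne_zero⟩; heckeT (Gamma0 L) 2 q).dualMap x ∈ K)
    (hcK : ∀ γ : Gamma0 L, periodFunctional L ⟨iotaConj (γ : SL(2, ℤ)), iotaConj_coe_mem_gamma0 γ⟩ - periodFunctional L γ ∈ K)
    {x y : Module.Dual ℂ (CuspForm (Gamma0 L) 2)} (hx : x ∈ periodHomology L) (hy : y ∈ periodHomology L)
    (hxK : x ∉ K) (hyK : y ∉ K) : x - y ∈ K := by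
  classical
  set G : Set (HeckeRing0 L 2) := {t : HeckeRing0 L 2 | t = 2 ∨ (∃ (q : ℕ) (hq : q.Prime), ¬ q ∣ L ∧
      t = HeckeRing0.T L 2 q hq - (W.LFunction q : HeckeRing0 L 2)) ∨ (∃ (q : ℕ) (hq : q.Prime), q ∣ L ∧
      t = HeckeRing0.T L 2 q hq)} with hGdef
  -- the depleted form and B5 from the facts
  obtain ⟨g, hg, hgall, -⟩ := exists_periodFunctional_iotaConj_sub_notMem_of_facts hES hF hMK W hss hΔ hf S hS hSne L hL
  -- primes of `L` are exactly `S`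
  have hLS : ∀ q : ℕ, q.Prime → (q ∣ L ↔ q ∈ S) := fun q hq ↦ by
    constructor
    · intro h
      by_contra hqS
      exact hqS (hSN q hq ((dvd_level_iff hS hL hq hqS).mp h))
    · exact fun h ↦ dvd_level_of_mem hL h
  -- `𝔪₀ = span G` contains `2` and acts on `g` by even integers
  have h2 : (2 : HeckeRing0 L 2) ∈ Ideal.span G := Ideal.subset_span (Or.inl rfl)
  have hb : ∀ (q : ℕ) (hq : q.Prime), (haveI : NeZero q := ⟨hq.ne_zero⟩; heckeT (Gamma0 L) 2 q g) =
      (((if q ∈ S then 0 else W.LFunction q : ℤ)) : ℂ) • g := fun q hq ↦ by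
    rw [hgall q hq, hg q]
    by_cases hqS : q ∈ S
    · rw [if_pos ⟨q, hqS, dvd_rfl⟩, if_pos hqS, Int.cast_zero]
    · rw [if_neg, if_neg hqS]
      rintro ⟨ℓ, hℓ, hd⟩
      exact hqS (((Nat.prime_dvd_prime_iff_eq (hS ℓ hℓ) hq).mp hd) ▸ hℓ)
  have h𝔪 : ∀ t ∈ Ideal.span G, ∃ e : ℤ, HeckeRing0.toEnd L 2 t g = ((2 * e : ℤ) : ℂ) • g := by
    refine ideal_span_acts_even g (fun q ↦ if q ∈ S then 0 else W.LFunction q) hb G fun t ht ↦ ?_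
    rcases ht with rfl | ⟨q, hq, hqL, rfl⟩ | ⟨q, hq, hqL, rfl⟩
    · exact Or.inl rfl
    · refine Or.inr ⟨q, hq, ?_⟩
      rw [if_neg (fun h ↦ hqL ((hLS q hq).mpr h))]
    · refine Or.inr ⟨q, hq, ?_⟩
      rw [if_pos ((hLS q hq).mp hqL), Int.cast_zero, sub_zero]
  -- `K ⊇ 𝔪₀ • Λ`
  have hK𝔪 : ∀ x ∈ Ideal.span G • periodHomologyHecke L, x ∈ K := by
    refine mem_of_mem_ideal_span_smul G K fun s hs z hz ↦ ?_
    rcases hs with rfl | ⟨q, hq, hqL, rfl⟩ | ⟨q, hq, hqL, rfl⟩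
    · have : (2 : HeckeRing0 L 2) • z = (2 : ℂ) • z := by
        rw [show (2 : HeckeRing0 L 2) = ((2 : ℤ) : HeckeRing0 L 2) by norm_num, heckeRing0_intCast_smul, Int.cast_ofNat]
      rw [this]
      exact h2K z hz
    · rw [sub_smul, heckeRing0_T_smul, heckeRing0_intCast_smul]
      exact hTK q hq hqL z hz
    · rw [heckeRing0_T_smul]
      exact hUK q hq hqL z hz
  exact indexTwo_of_fourCosets_of_facts hES hF hMK W hss hΔ hf S hS hSne L hL g hg (Ideal.span G) h2 h𝔪 K hK𝔪 hcK hv₂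
    hcos hx hy hxK hyK

end KTwo

end Summit.BirchSwinnertonDyer.BirchSwinnertonDyer.Theorems.ThetaLayerLambdaCongruenceAtTwo

end
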